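import Mathlib
import Literature.Analysis.FluidPDE.VectorCalculus
import Summits.NavierStokesRegularity.NavierStokesRegularity.Theorems.FilamentSkeletonRssClause13RAdjointWaistSourced
import Summits.NavierStokesRegularity.NavierStokesRegularity.Theorems.FilamentSkeletonRssClause13RAdjointWaistSourcedLeft

/-!
# Clause 13-R, STUB R at MODEL level: an `L¹` adjoint density is WAIST-REGULAR — the blow-up branch carries no finite measure
# (crux `Clause13RNearStraightL`, stmt-NavierStokesRegularity-23612; line `rate_bordered_split`, STUB R `stub_rateRow13RFlat`)

Route `FilamentSkeletonRss`, Variant A1R.  Closing step of the local classification at the stagnation point `c` of the slip `w`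
(`…Clause13RAdjointWaistLaw` p830871, `…Clause13RAdjointWaistSourced` p831138, `…Left` p831220): the DICHOTOMY there says a solution of the
sourced local adjoint equation `w φ′ + (½ + w′)φ + αe×φ + cst·m(φ×d) = g` on the punctured half-ball is either within the regular budget
`|w(σ)|‖φ(σ)‖ ≤ G|σ − c|` (waist-regular) or has `|w|‖φ‖ ≥ m > 0` into the waist.  THIS FILE proves that the second alternative is NOT
INTEGRABLE when the slip opens at most linearly (`|w(s)| ≤ κ₂|s − c|`, as for a `C¹` slip): `‖φ(s)‖ ≥ m/(κ₂|s − c|)` and `(s − c)⁻¹ ∉ L¹`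
(`not_integrableOn_of_wnorm_ge_right/_left`, via Mathlib's `intervalIntegrable_sub_inv_iff`).  Hence (`wnorm_le_of_integrableOn_right/_left`):
**every `L¹` solution on a punctured half-ball is waist-regular**, `|w(σ)|‖φ(σ)‖ ≤ G|σ − c|` — so it is THE regular branch (unique,
`…WaistSourced.waistRegular_unique_right`), bounded by `G/κ₁` when `|w| ≥ κ₁|s − c|` (`norm_le_of_integrableOn_right`), and ZERO for `g = 0`
(`eq_zero_of_integrableOn_right/_left`).  Planner-facing meaning (memo DIAG-23612-R-currency-leafhand19-g0.md §3 (F1)): the density part of an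
annihilating MEASURE of the model operator (a priori only `L¹`) is automatically the bounded waist-regular branch on each side of the waist; with
p828845 (no `C¹` annihilator) and p830801 (no piecewise-`C¹` annihilator) no interior density and no waist atom enlarges the 4-parameter EDGE
cokernel — «the rate row of 13-R is pure edge information» at model level.  [folklore]
Hand `leafhand-ns-filamentskeletonrs-19-g0` (LAND-ONLY); `--supports stmt-NavierStokesRegularity-23612` helper, def-free.  HONEST FRAMING: ODE /
integrability bookkeeping for the MODEL adjoint equation attached to a HYPOTHETICAL filament skeleton on the NEGATIVE side of a MODEL blow-up
route; STUB R is NOT proved here and nothing in this file bears on Navier–Stokes regularity or blow-up.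
-/

noncomputable section

open MeasureTheory Filter Topology Set
open scoped RealInnerProductSpace InnerProductSpace
open Literature.Analysis.FluidPDE
open Summit.NavierStokesRegularity.NavierStokesRegularity.Theorems.Clause13RAdjointWaistSourced
  (waist_dichotomy_right norm_le_of_waistRegular_right waistRegular_of_wnorm_le eq_zero_of_waistRegular_right)
open Summit.NavierStokesRegularity.NavierStokesRegularity.Theorems.Clause13RAdjointWaistSourcedLeft
  (wnorm_ge_of_sourced_left eq_zero_of_waistRegular_left)

namespace Summit.NavierStokesRegularity.NavierStokesRegularity.Theorems.Clause13RAdjointWaistIntegrable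
set_option linter.dupNamespace false

/-! ## §1 The blow-up branch is not integrable -/

/-- **The blow-up branch carries no finite measure (right half-ball).**  If `m ≤ w(s)‖φ(s)‖` on `(c, σ₀]` with `m > 0` and the slip
opens at most linearly, `w(s) ≤ κ₂(s − c)` there, then `‖φ(s)‖ ≥ m/(κ₂(s − c))` and `φ` is NOT integrable on `(c, σ₀]`. [folklore] -/
theorem not_integrableOn_of_wnorm_ge_right {c σ₀ m₀ κ₂ : ℝ} {w : ℝ → ℝ} {φ : ℝ → EuclideanSpace ℝ (Fin 3)} (hσ₀ : c < σ₀)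
    (hm : 0 < m₀) (hwup : ∀ s ∈ Ioc c σ₀, w s ≤ κ₂ * (s - c)) (hge : ∀ s ∈ Ioc c σ₀, m₀ ≤ w s * ‖φ s‖) :
    ¬ IntegrableOn φ (Ioc c σ₀) := by
  intro hint
  have hbound : ∀ s ∈ Ioc c σ₀, ‖(s - c)⁻¹‖ ≤ κ₂ / m₀ * ‖φ s‖ := by
    intro s hs
    have hsc : 0 < s - c := sub_pos.2 hs.1
    have h1 : m₀ ≤ κ₂ * (s - c) * ‖φ s‖ :=
      (hge s hs).trans (mul_le_mul_of_nonneg_right (hwup s hs) (norm_nonneg _))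
    rw [Real.norm_eq_abs, abs_of_pos (inv_pos.2 hsc), inv_eq_one_div, div_le_iff₀ hsc,
      show κ₂ / m₀ * ‖φ s‖ * (s - c) = κ₂ * (s - c) * ‖φ s‖ / m₀ by ring, le_div_iff₀ hm, one_mul]
    exact h1
  have hmeas : AEStronglyMeasurable (fun s : ℝ => (s - c)⁻¹) (volume.restrict (Ioc c σ₀)) :=
    (ContinuousOn.inv₀ (continuousOn_id.sub continuousOn_const) fun s hs => (sub_pos.2 hs.1).ne').aestronglyMeasurable
      measurableSet_Ioc
  have hinv : IntegrableOn (fun s : ℝ => (s - c)⁻¹) (Ioc c σ₀) :=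
    Integrable.mono' (hint.norm.const_mul (κ₂ / m₀)) hmeas (ae_restrict_of_forall_mem measurableSet_Ioc hbound)
  have hii : IntervalIntegrable (fun s : ℝ => (s - c)⁻¹) volume c σ₀ :=
    (intervalIntegrable_iff_integrableOn_Ioc_of_le hσ₀.le).2 hinv
  rcases intervalIntegrable_sub_inv_iff.1 hii with h | h
  · exact absurd h hσ₀.ne
  · exact h left_mem_uIcc

/-- **The blow-up branch carries no finite measure (left half-ball).**  If `m ≤ |w(s)|‖φ(s)‖` on `[σ₀, c)` with `m > 0` and
`|w(s)| ≤ κ₂(c − s)` there, then `φ` is NOT integrable on `[σ₀, c)`. [folklore] -/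
theorem not_integrableOn_of_wnorm_ge_left {σ₀ c m₀ κ₂ : ℝ} {w : ℝ → ℝ} {φ : ℝ → EuclideanSpace ℝ (Fin 3)} (hσ₀ : σ₀ < c)
    (hm : 0 < m₀) (hwup : ∀ s ∈ Ico σ₀ c, |w s| ≤ κ₂ * (c - s)) (hge : ∀ s ∈ Ico σ₀ c, m₀ ≤ |w s| * ‖φ s‖) :
    ¬ IntegrableOn φ (Ico σ₀ c) := by
  intro hint
  have hbound : ∀ s ∈ Ico σ₀ c, ‖(s - c)⁻¹‖ ≤ κ₂ / m₀ * ‖φ s‖ := by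
    intro s hs
    have hsc : 0 < c - s := sub_pos.2 hs.2
    have h1 : m₀ ≤ κ₂ * (c - s) * ‖φ s‖ :=
      (hge s hs).trans (mul_le_mul_of_nonneg_right (hwup s hs) (norm_nonneg _))
    rw [Real.norm_eq_abs, show (s - c)⁻¹ = -(c - s)⁻¹ by rw [← neg_sub, inv_neg], abs_neg, abs_of_pos (inv_pos.2 hsc),
      inv_eq_one_div, div_le_iff₀ hsc,
      show κ₂ / m₀ * ‖φ s‖ * (c - s) = κ₂ * (c - s) * ‖φ s‖ / m₀ by ring, le_div_iff₀ hm, one_mul]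
    exact h1
  have hmeas : AEStronglyMeasurable (fun s : ℝ => (s - c)⁻¹) (volume.restrict (Ico σ₀ c)) :=
    (ContinuousOn.inv₀ (continuousOn_id.sub continuousOn_const) fun s hs => (sub_neg.2 hs.2).ne).aestronglyMeasurable
      measurableSet_Ico
  have hinv : IntegrableOn (fun s : ℝ => (s - c)⁻¹) (Ico σ₀ c) :=
    Integrable.mono' (hint.norm.const_mul (κ₂ / m₀)) hmeas (ae_restrict_of_forall_mem measurableSet_Ico hbound)
  have hinv' : IntegrableOn (fun s : ℝ => (s - c)⁻¹) (Ioc σ₀ c) := by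
    rw [integrableOn_Ioc_iff_integrableOn_Ioo, ← integrableOn_Ico_iff_integrableOn_Ioo]
    exact hinv
  have hii : IntervalIntegrable (fun s : ℝ => (s - c)⁻¹) volume σ₀ c :=
    (intervalIntegrable_iff_integrableOn_Ioc_of_le hσ₀.le).2 hinv'
  rcases intervalIntegrable_sub_inv_iff.1 hii with h | h
  · exact absurd h hσ₀.ne
  · exact h right_mem_uIcc

/-! ## §2 `L¹` on a punctured half-ball ⟹ waist-regular (right) -/

/-- **`L¹ ⟹` WAIST-REGULAR (right half-ball).**  A solution of the sourced local adjoint equation on the punctured half-ball `(c, σ₁]`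
(`C¹` there only, nothing assumed at `c`), INTEGRABLE on `(c, σ₁]`, under a slip `0 ≤ w(s) ≤ κ₂(s − c)` and a source `‖g‖ ≤ G`, is within the
regular budget at every station: `w(σ)‖φ(σ)‖ ≤ G(σ − c)` on `(c, σ₁]`. [folklore] -/
theorem wnorm_le_of_integrableOn_right {c σ₁ cst α G κ₂ : ℝ} {m w w' : ℝ → ℝ} {φ φ' g : ℝ → EuclideanSpace ℝ (Fin 3)}
    {d e : EuclideanSpace ℝ (Fin 3)}
    (hw : ∀ s ∈ Ioc c σ₁, HasDerivAt w (w' s) s) (hφ : ∀ s ∈ Ioc c σ₁, HasDerivAt φ (φ' s) s)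
    (hwnn : ∀ s ∈ Ioc c σ₁, 0 ≤ w s) (hwup : ∀ s ∈ Ioc c σ₁, w s ≤ κ₂ * (s - c)) (hg : ∀ s ∈ Ioc c σ₁, ‖g s‖ ≤ G)
    (heq : ∀ s ∈ Ioc c σ₁,
      w s • φ' s + (1 / 2 : ℝ) • φ s + w' s • φ s + α • cross e (φ s) + (cst * m s) • cross (φ s) d = g s)
    (hint : IntegrableOn φ (Ioc c σ₁)) {σ : ℝ} (hσ : σ ∈ Ioc c σ₁) : w σ * ‖φ σ‖ ≤ G * (σ - c) := by
  rcases waist_dichotomy_right hw hφ hwnn hg heq with h | ⟨m₀, hm₀, σ₀, hσ₀, hge⟩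
  · exact h σ hσ
  · exfalso
    have hsub : Ioc c σ₀ ⊆ Ioc c σ₁ := fun x hx => ⟨hx.1, hx.2.trans hσ₀.2⟩
    exact not_integrableOn_of_wnorm_ge_right hσ₀.1 hm₀ (fun s hs => hwup s (hsub hs)) hge (hint.mono_set hsub)

/-- Hence an `L¹` solution on `(c, σ₁]` IS waist-regular: `w‖φ‖ → 0` at `c⁺`. [folklore] -/
theorem waistRegular_of_integrableOn_right {c σ₁ cst α G κ₂ : ℝ} {m w w' : ℝ → ℝ} {φ φ' g : ℝ → EuclideanSpace ℝ (Fin 3)}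
    {d e : EuclideanSpace ℝ (Fin 3)} (hσ₁ : c < σ₁)
    (hw : ∀ s ∈ Ioc c σ₁, HasDerivAt w (w' s) s) (hφ : ∀ s ∈ Ioc c σ₁, HasDerivAt φ (φ' s) s)
    (hwnn : ∀ s ∈ Ioc c σ₁, 0 ≤ w s) (hwup : ∀ s ∈ Ioc c σ₁, w s ≤ κ₂ * (s - c)) (hg : ∀ s ∈ Ioc c σ₁, ‖g s‖ ≤ G)
    (heq : ∀ s ∈ Ioc c σ₁,
      w s • φ' s + (1 / 2 : ℝ) • φ s + w' s • φ s + α • cross e (φ s) + (cst * m s) • cross (φ s) d = g s)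
    (hint : IntegrableOn φ (Ioc c σ₁)) : Tendsto (fun s => w s * ‖φ s‖) (𝓝[>] c) (𝓝 0) :=
  waistRegular_of_wnorm_le hσ₁ hwnn fun _ hs => wnorm_le_of_integrableOn_right hw hφ hwnn hwup hg heq hint hs

/-- **SUP BOUND for `L¹` solutions (right half-ball).**  Under a two-sided linear slip `κ₁(s − c) ≤ w(s) ≤ κ₂(s − c)` (`κ₁ > 0`), every
INTEGRABLE solution of the sourced local equation on `(c, σ₁]` is BOUNDED: `‖φ(σ)‖ ≤ G/κ₁` — an `L¹` annihilating density is bounded by its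
source (nonlocal term + edge kernels) alone. [folklore] -/
theorem norm_le_of_integrableOn_right {c σ₁ cst α G κ₁ κ₂ : ℝ} {m w w' : ℝ → ℝ} {φ φ' g : ℝ → EuclideanSpace ℝ (Fin 3)}
    {d e : EuclideanSpace ℝ (Fin 3)} (hκ : 0 < κ₁)
    (hwlow : ∀ s ∈ Ioc c σ₁, κ₁ * (s - c) ≤ w s) (hwup : ∀ s ∈ Ioc c σ₁, w s ≤ κ₂ * (s - c))
    (hw : ∀ s ∈ Ioc c σ₁, HasDerivAt w (w' s) s) (hφ : ∀ s ∈ Ioc c σ₁, HasDerivAt φ (φ' s) s)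
    (hg : ∀ s ∈ Ioc c σ₁, ‖g s‖ ≤ G)
    (heq : ∀ s ∈ Ioc c σ₁,
      w s • φ' s + (1 / 2 : ℝ) • φ s + w' s • φ s + α • cross e (φ s) + (cst * m s) • cross (φ s) d = g s)
    (hint : IntegrableOn φ (Ioc c σ₁)) {σ : ℝ} (hσ : σ ∈ Ioc c σ₁) : ‖φ σ‖ ≤ G / κ₁ := by
  have hwnn : ∀ s ∈ Ioc c σ₁, 0 ≤ w s :=
    fun s hs => (mul_nonneg hκ.le (sub_nonneg.2 hs.1.le)).trans (hwlow s hs)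
  exact norm_le_of_waistRegular_right hκ hwlow hw hφ hg heq
    (waistRegular_of_integrableOn_right (hσ.1.trans_le hσ.2) hw hφ hwnn hwup hg heq hint) hσ

/-- **NO nonzero `L¹` branch of the homogeneous equation (right half-ball).**  An integrable solution of the HOMOGENEOUS local adjoint
equation on `(c, σ₁]` (`C¹` there only), under `0 ≤ w(s) ≤ κ₂(s − c)`, vanishes wherever `w ≠ 0`: in the model, the only local homogeneous
branches are `0` and the non-integrable `≍ 1/w` ones. [folklore] -/
theorem eq_zero_of_integrableOn_right {c σ₁ cst α κ₂ : ℝ} {m w w' : ℝ → ℝ} {φ φ' : ℝ → EuclideanSpace ℝ (Fin 3)}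
    {d e : EuclideanSpace ℝ (Fin 3)}
    (hw : ∀ s ∈ Ioc c σ₁, HasDerivAt w (w' s) s) (hφ : ∀ s ∈ Ioc c σ₁, HasDerivAt φ (φ' s) s)
    (hwnn : ∀ s ∈ Ioc c σ₁, 0 ≤ w s) (hwup : ∀ s ∈ Ioc c σ₁, w s ≤ κ₂ * (s - c))
    (heq : ∀ s ∈ Ioc c σ₁,
      w s • φ' s + (1 / 2 : ℝ) • φ s + w' s • φ s + α • cross e (φ s) + (cst * m s) • cross (φ s) d = 0)
    (hint : IntegrableOn φ (Ioc c σ₁)) {σ : ℝ} (hσ : σ ∈ Ioc c σ₁) (hwσ : w σ ≠ 0) : φ σ = 0 :=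
  eq_zero_of_waistRegular_right hw hφ hwnn heq
    (waistRegular_of_integrableOn_right (g := fun _ => 0) (G := 0) (hσ.1.trans_le hσ.2) hw hφ hwnn hwup (fun s _ => by simp)
      (fun s hs => by rw [heq s hs]) hint) hσ hwσ

/-! ## §3 `L¹` on a punctured half-ball ⟹ waist-regular (left) -/

/-- **`L¹ ⟹` WAIST-REGULAR (left half-ball).**  A solution of the sourced local adjoint equation on `[σ₁, c)` (`C¹` there only), INTEGRABLE
there, under a slip `w ≤ 0`, `|w(s)| ≤ κ₂(c − s)` and a source `‖g‖ ≤ G`, satisfies `|w(σ)|‖φ(σ)‖ ≤ G(c − σ)` on `[σ₁, c)`. [folklore] -/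
theorem wnorm_le_of_integrableOn_left {σ₁ c cst α G κ₂ : ℝ} {m w w' : ℝ → ℝ} {φ φ' g : ℝ → EuclideanSpace ℝ (Fin 3)}
    {d e : EuclideanSpace ℝ (Fin 3)}
    (hw : ∀ s ∈ Ico σ₁ c, HasDerivAt w (w' s) s) (hφ : ∀ s ∈ Ico σ₁ c, HasDerivAt φ (φ' s) s)
    (hwnp : ∀ s ∈ Ico σ₁ c, w s ≤ 0) (hwup : ∀ s ∈ Ico σ₁ c, |w s| ≤ κ₂ * (c - s)) (hg : ∀ s ∈ Ico σ₁ c, ‖g s‖ ≤ G)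
    (heq : ∀ s ∈ Ico σ₁ c,
      w s • φ' s + (1 / 2 : ℝ) • φ s + w' s • φ s + α • cross e (φ s) + (cst * m s) • cross (φ s) d = g s)
    (hint : IntegrableOn φ (Ico σ₁ c)) {σ : ℝ} (hσ : σ ∈ Ico σ₁ c) : |w σ| * ‖φ σ‖ ≤ G * (c - σ) := by
  by_contra hlt
  have hlt' : G * (c - σ) < |w σ| * ‖φ σ‖ := not_le.mp hlt
  have hsub : Ico σ c ⊆ Ico σ₁ c := fun x hx => ⟨hσ.1.trans hx.1, hx.2⟩
  have hge : ∀ s ∈ Ico σ c, |w σ| * ‖φ σ‖ - G * (c - σ) ≤ |w s| * ‖φ s‖ := fun s hs =>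
    wnorm_ge_of_sourced_left (fun x hx => hw x (hsub hx)) (fun x hx => hφ x (hsub hx)) (fun x hx => hwnp x (hsub hx))
      (fun x hx => hg x (hsub hx)) (fun x hx => heq x (hsub hx)) hs
  exact not_integrableOn_of_wnorm_ge_left hσ.2 (sub_pos.2 hlt') (fun s hs => hwup s (hsub hs)) hge (hint.mono_set hsub)

/-- **NO nonzero `L¹` branch of the homogeneous equation (left half-ball).** [folklore] -/
theorem eq_zero_of_integrableOn_left {σ₁ c cst α κ₂ : ℝ} {m w w' : ℝ → ℝ} {φ φ' : ℝ → EuclideanSpace ℝ (Fin 3)}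
    {d e : EuclideanSpace ℝ (Fin 3)}
    (hw : ∀ s ∈ Ico σ₁ c, HasDerivAt w (w' s) s) (hφ : ∀ s ∈ Ico σ₁ c, HasDerivAt φ (φ' s) s)
    (hwnp : ∀ s ∈ Ico σ₁ c, w s ≤ 0) (hwup : ∀ s ∈ Ico σ₁ c, |w s| ≤ κ₂ * (c - s))
    (heq : ∀ s ∈ Ico σ₁ c,
      w s • φ' s + (1 / 2 : ℝ) • φ s + w' s • φ s + α • cross e (φ s) + (cst * m s) • cross (φ s) d = 0)
    (hint : IntegrableOn φ (Ico σ₁ c)) {σ : ℝ} (hσ : σ ∈ Ico σ₁ c) (hwσ : w σ ≠ 0) : φ σ = 0 := by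
  have h := wnorm_le_of_integrableOn_left (g := fun _ => 0) (G := 0) hw hφ hwnp hwup (fun s _ => by simp)
    (fun s hs => by rw [heq s hs]) hint hσ
  have hwpos : 0 < |w σ| := abs_pos.2 hwσ
  have hn : ‖φ σ‖ ≤ 0 := by
    by_contra hlt
    have := mul_pos hwpos (not_le.mp hlt)
    linarith
  exact norm_eq_zero.mp (le_antisymm hn (norm_nonneg _))

end Summit.NavierStokesRegularity.NavierStokesRegularity.Theorems.Clause13RAdjointWaistIntegrable

end
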